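import Literature.NumberTheory.Automorphic.ArtinConjectureMonomialProofs
import Literature.NumberTheory.Automorphic.LanglandsTunnellBridgeEigenModel
import HarnessLib

/-!
# The Langlands–Tunnell continuation target from the strong Artin cases and the four true
automorphic facts behind Tunnell's bridge
(pure proofs; companion to `Literature.NumberTheory.Automorphic.ArtinConjectureMonomialProofs`
and `Literature.NumberTheory.Automorphic.LanglandsTunnellBridgeEigenModel`)

Topic `NumberTheory/Automorphic`; namespace `Literature.NumberTheory.Automorphic`. Everything in
this file is PROVED (no `sorry`, no definition, no new named fact, nothing restated).

`ArtinConjectureMonomialProofs` proves the named fact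
`Literature.NumberTheory.Automorphic.langlands_tunnell_hasEntireContinuation` of
`Automorphic/ArtinLFunctions` (Tunnell, Bull. AMS 5 (1981), p. 173 and Theorem p. 175, special case
`F = ℚ`: for `ρ : Γ_ℚ → GL_2(ℂ)` continuous, irreducible, odd, with solvable image, `L(s, ρ)` has
entire continuation) from the tetrahedral and octahedral cases of the strong Artin conjecture and
*five* automorphic named facts behind Tunnell's bridge "`π = π(ρ)` ⟹ `L(s, ρ)` entire"
(`langlands_tunnell_hasEntireContinuation_of_strongArtin_of_facts`), the fifth being the family
`∀ F hcpt, cuspidal_W'_eq_bot (n := 2) hcpt` ("a cuspidal `W / W'` is realised on a stable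
complement of `W'`").  That named fact has since been **refuted for `GL_1`** in the tree
(`not_cuspidal_W'_eq_bot_gl_one'`, `not_forall_cuspidal_W'_eq_bot` of
`AutomorphicRepsGLLogDetCounterexample`: the datum `span {log ‖det‖_𝔸, 1} / ℂ·1`), and
`LanglandsTunnellBridgeEigenModel` has proved the `A_G`-normalisation it was used for outright
(`CuspidalAutomorphicRepData.exists_centerInvariant_hasSatakeParamAt_shift_eventually`), reassembling
the bridge from the *four* remaining named facts
(`hasEntireContinuation_artinLFunction_of_isPiOfArtinRep_of_four_facts`).

This file threads that improvement through to the target and to Artin's conjecture for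
two-dimensional `σ` with solvable image over any number field, so that the remaining trust base of
`langlands_tunnell_hasEntireContinuation` reads off one statement with no refuted or vacuous
hypothesis:

* `hasEntireContinuation_artinLFunction_of_isSolvable_of_strongArtin_of_four_facts` — for every
  number field `F` and every continuous irreducible `σ : Γ_F → GL_2(ℂ)` with solvable image,
  `L(s, σ)` is entire, granting (T) `strongArtin_of_isTetrahedralType` (Langlands 1980, §3),
  (O) `strongArtin_of_isOctahedralType` (Tunnell 1981, Theorem), (FE) `artin_functional_equation`
  over every number field (Artin 1931 / Neukirch VII (12.6)), (GJ) `godementJacquet (n := 2)`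
  (Godement–Jacquet 1972, Thm. 13.8; Jacquet–Langlands 1970, Thm. 11.1), and Borel–Jacquet's
  dictionary (A) `AutomorphicRepsGL.exists_isAssociatedL2`, (L2) `hasSatakeParamAt_iff_L2`
  (Borel–Jacquet 1979, 4.4–4.6).  The dihedral case is the *theorem*
  `artinLFunction_hasEntireContinuation_of_isDihedralType` (Artin 1931 + class field theory, proved
  in the tree), finite image and the Klein trichotomy are theorems of the tree.
* `langlands_tunnell_hasEntireContinuation_of_strongArtin_of_four_facts` — the target over `ℚ`
  from the same six hypotheses (oddness is not used on this road).

Consequently `langlands_tunnell_hasEntireContinuation_holds` is the term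
`langlands_tunnell_hasEntireContinuation_of_strongArtin_of_four_facts` applied to the six `_holds`
theorems of (T), (O), (FE), (GJ), (A), (L2), once they exist; each of these is a theorem of the
theory of automorphic representations of `GL_1`/`GL_2`/`GL_3` (base change and the trace formula,
Tate's thesis, Whittaker models, reduction theory) with its own entry in the tree.

## References

* J. Tunnell, *Artin's conjecture for representations of octahedral type*, Bull. AMS (N.S.) 5
  (1981), 173–175: p. 173 ¶1–2 and Theorem (p. 175). [Tunnell1981]
* R. P. Langlands, *Base change for GL(2)*, Ann. of Math. Studies 96 (1980), §3.
  [LanglandsBaseChange1980]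
* R. Godement, H. Jacquet, *Zeta functions of simple algebras*, LNM 260 (1972), Thm. 13.8.
  [GodementJacquet1972]
* A. Borel, H. Jacquet, *Automorphic forms and automorphic representations*, Proc. Sympos. Pure
  Math. 33 (1979), part 1, 4.4–4.6 and 5.7. [BorelJacquetCorvallis1979]
* J. Neukirch, *Algebraic Number Theory* (1999), VII §12, Thm. (12.6). [NeukirchANT1999]
-/

noncomputable section

open MeasureTheory

namespace Literature.NumberTheory.Automorphic

/-! ### Any number field: irreducible `σ : Γ_F → GL_2(ℂ)` with solvable image -/

section DegreeTwo

variable {F : Type} [Field F] [NumberField F]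

/-- **Artin's conjecture for irreducible two-dimensional `σ` with solvable image, from the strong
Artin cases and the four true automorphic facts behind Tunnell's bridge** (Tunnell 1981, p. 173:
monomial (Artin) + tetrahedral (Langlands) + octahedral (Tunnell), and ¶2 "When `π = π(ρ)` the
L-series of `π` and `ρ` agree, and since cuspidal representations have entire L-series, Artin's
conjecture follows").  Granting (T) `strongArtin_of_isTetrahedralType`, (O)
`strongArtin_of_isOctahedralType`, (FE) Artin's functional equation over every number field, (GJ)
Godement–Jacquet for cuspidal `GL₂`, and Borel–Jacquet's dictionary (A), (L2) with `L²_cusp`, every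
continuous irreducible `σ : Γ_F → GL_2(ℂ)` with solvable image has entire Artin L-function:
`hasEntireContinuation_artinLFunction_of_isSolvable_of_strongArtin_of_bridge`
(`ArtinConjectureMonomialProofs`; dihedral leg proved there) with the bridge supplied by
`hasEntireContinuation_artinLFunction_of_isPiOfArtinRep_of_four_facts`
(`LanglandsTunnellBridgeEigenModel`, where the `A_G`-normalisation formerly drawn from the refuted
`cuspidal_W'_eq_bot` is a theorem).
[cite: Tunnell1981, p. 173 and Theorem] [cite: LanglandsBaseChange1980, §3]
[cite: GodementJacquet1972, Thm. 13.8] [cite: BorelJacquetCorvallis1979, §4.6 and 5.7]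
[cite: NeukirchANT1999, VII §12, Thm. (12.6)] -/
theorem hasEntireContinuation_artinLFunction_of_isSolvable_of_strongArtin_of_four_facts
    (ht : strongArtin_of_isTetrahedralType) (ho : strongArtin_of_isOctahedralType)
    (hFE : ∀ (F : Type) [Field F] [NumberField F], artin_functional_equation (K := F))
    (hGJ : ∀ (F : Type) [Field F] [NumberField F]
      (μ : Measure (AdelicGroupData.gl 2 F).automorphicQuotient)
      [(AdelicGroupData.gl 2 F).IsAutomorphicMeasure μ], godementJacquet (n := 2) (K := F) (μ := μ))
    (hA : ∀ (F : Type) [Field F] [NumberField F] (hcpt : isCompact_glFiniteIntegralLevel 2 F)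
      (μ : Measure (AdelicGroupData.gl 2 F).automorphicQuotient)
      [(AdelicGroupData.gl 2 F).IsAutomorphicMeasure μ], AutomorphicRepsGL.exists_isAssociatedL2 hcpt μ)
    (hL2 : ∀ (F : Type) [Field F] [NumberField F] (hcpt : isCompact_glFiniteIntegralLevel 2 F)
      (μ : Measure (AdelicGroupData.gl 2 F).automorphicQuotient)
      [(AdelicGroupData.gl 2 F).IsAutomorphicMeasure μ], hasSatakeParamAt_iff_L2 hcpt μ)
    (σ : GaloisRepresentations.FramedArtinRep F 2) (hirr : σ.toGaloisRep.IsIrreducible)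
    (hsolv : IsSolvable σ.toMonoidHom.range) :
    GaloisRepresentations.LFunction.HasEntireContinuation
      (GaloisRepresentations.artinLFunction σ.toArtinRep) :=
  hasEntireContinuation_artinLFunction_of_isSolvable_of_strongArtin_of_bridge ht ho
    (hasEntireContinuation_artinLFunction_of_isPiOfArtinRep_of_four_facts hFE hGJ hA hL2) σ hirr hsolv

end DegreeTwo

/-! ### The target (`F = ℚ`) -/

/-- **`langlands_tunnell_hasEntireContinuation` from the strong Artin cases and the four true
automorphic named facts behind the bridge** — the current trust base of the named fact in one
statement: (T) `strongArtin_of_isTetrahedralType`, (O) `strongArtin_of_isOctahedralType`, (FE)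
`artin_functional_equation` over every number field, (GJ) `godementJacquet (n := 2)`, (A)
`AutomorphicRepsGL.exists_isAssociatedL2`, (L2) `hasSatakeParamAt_iff_L2`; the dihedral case, finite
image, the Klein trichotomy, the `A_G`-normalisation of cuspidal data and the functional-equation
gluing are theorems of the tree, and oddness is not used
(`langlands_tunnell_hasEntireContinuation_of_strongArtin_of_bridge` with
`hasEntireContinuation_artinLFunction_of_isPiOfArtinRep_of_four_facts`).  This supersedes
`langlands_tunnell_hasEntireContinuation_of_strongArtin_of_facts`, whose fifth hypothesis
`∀ F hcpt, cuspidal_W'_eq_bot hcpt` belongs to a named fact refuted for `GL_1`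
(`not_forall_cuspidal_W'_eq_bot`).
[cite: Tunnell1981, p. 173 and Theorem] [cite: LanglandsBaseChange1980, §3]
[cite: GodementJacquet1972, Thm. 13.8] [cite: BorelJacquetCorvallis1979, §4.6 and 5.7]
[cite: NeukirchANT1999, VII §12, Thm. (12.6)] -/
theorem langlands_tunnell_hasEntireContinuation_of_strongArtin_of_four_facts
    (ht : strongArtin_of_isTetrahedralType) (ho : strongArtin_of_isOctahedralType)
    (hFE : ∀ (F : Type) [Field F] [NumberField F], artin_functional_equation (K := F))
    (hGJ : ∀ (F : Type) [Field F] [NumberField F]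
      (μ : Measure (AdelicGroupData.gl 2 F).automorphicQuotient)
      [(AdelicGroupData.gl 2 F).IsAutomorphicMeasure μ], godementJacquet (n := 2) (K := F) (μ := μ))
    (hA : ∀ (F : Type) [Field F] [NumberField F] (hcpt : isCompact_glFiniteIntegralLevel 2 F)
      (μ : Measure (AdelicGroupData.gl 2 F).automorphicQuotient)
      [(AdelicGroupData.gl 2 F).IsAutomorphicMeasure μ], AutomorphicRepsGL.exists_isAssociatedL2 hcpt μ)
    (hL2 : ∀ (F : Type) [Field F] [NumberField F] (hcpt : isCompact_glFiniteIntegralLevel 2 F)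
      (μ : Measure (AdelicGroupData.gl 2 F).automorphicQuotient)
      [(AdelicGroupData.gl 2 F).IsAutomorphicMeasure μ], hasSatakeParamAt_iff_L2 hcpt μ) :
    langlands_tunnell_hasEntireContinuation :=
  langlands_tunnell_hasEntireContinuation_of_strongArtin_of_bridge ht ho
    (hasEntireContinuation_artinLFunction_of_isPiOfArtinRep_of_four_facts hFE hGJ hA hL2)

end Literature.NumberTheory.Automorphic

end
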